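import Literature.Topology.FourManifolds.ParallelizablePullback
import Literature.Topology.FourManifolds.BallRemovalCobordism
import HarnessLib

/-!
# Framings descend to the ball complement `K = W ∖ i(B̊)`: (stable) parallelizability of the
# ball-removal manifold, and of a closed manifold recharted on the half-space

Topic `Literature/Topology/FourManifolds` (barrier seat
`provefact-Literature.Barriers.SmoothPoincare4.Stab-ad8c696e34`, seat 1: the cobordism
`(W ∖ B̊⁵; Σ, S⁴)` cut out of a PARALLELIZABLE null-cobordism `W` of a homotopy 4-sphere is
parallelizable — Kirby, *The Topology of 4-Manifolds* (1989), Ch. VIII p. 50, the handlebody of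
`W` "with only one 0-handle", framed).  Everything is PROVED; no definition, no named fact.

M. Kervaire, J. Milnor, *Groups of homotopy spheres I*, Ann. of Math. 77 (1963), proof of
Lemma 2.3 (p. 506): "removing the interior of an imbedded disk we obtain a … manifold `W` with
`bW = M + (-Sⁿ)`"; an open subset of a parallelizable manifold is parallelizable, and so is every
manifold immersed equidimensionally in one (Hirsch, *Differential Topology* (1976), Ch. 4 §1 p. 88
and §2: `TM ≅ φ*TN` for an equidimensional immersion `φ`).  The tree's ball complement
`BallRemovalData.K` (`BallRemovalCobordism.lean`) is the glued manifold `A ∪ B` of the open piece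
`A = W ∖ i(B̄)` and the collar piece `B = {½ < ‖b‖} ⊆ 𝔻ⁿ⁺¹`, which maps to `W` by `a ↦ a`,
`b ↦ i(b/‖b‖²)` — an equidimensional immersion (indeed the embedding `K ≅ W ∖ i(B̊)`,
`BallRemovalData.homeomorph`); framings of `TW` pull back along it.

* `IsStablyParallelizable.of_hasStableTangentFramingAlong_of_isInvertible_mfderiv` — the
  STABLE analogue of `IsParallelizable.of_hasTangentFramingAlong_of_isInvertible_mfderiv`
  (`ParallelizablePullback.lean`): a stable framing of `TN` along an equidimensional immersion
  `φ : M → N` pulls back to a stable framing of `TM` (`(dφ)⁻¹` on the tangent component, the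
  identity on the trivial line);
* `SmoothGlueData.contMDiff_liftH`, `SmoothGlueData.isInvertible_mfderiv_lift_inl/inr` — maps out
  of a glued manifold WITH BOUNDARY (`GluingConstructionBoundary.lean`) are smooth, resp. have
  invertible differential, when their two components do (the pieces embed as open submanifolds,
  hence as local diffeomorphisms);
* `BallRemovalData.val_eq_glueInvPt_glue`, `BallRemovalData.contMDiff_toAmbient`,
  `BallRemovalData.isInvertible_mfderiv_toAmbient` — the map `K → W` and its differential;
* `BallRemovalData.isParallelizable_K`, `BallRemovalData.isStablyParallelizable_K` — **`K` is
  (stably) parallelizable when `W` is**;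
* `HalfSpaceCharted.isStablyParallelizable`, `HalfSpaceCharted.isParallelizable` — a closed
  manifold recharted on the half-space (`ClosedAsCobordism.lean`) keeps its (stable) framings
  (pull-back along the identity `HalfSpaceCharted X → X`, `HalfSpaceCharted.isInvertible_mfderiv_of_symm`).

## References

* M. Kervaire, J. Milnor, *Groups of homotopy spheres I*, Ann. of Math. 77 (1963), proof of
  Lemma 2.3 (p. 506); §3 p. 508. [KervaireMilnorAnnals1963]
* M. W. Hirsch, *Differential Topology*, GTM 33 (1976), Ch. 4 §1 p. 88, §2. [Hirsch1976]
* R. C. Kirby, *The Topology of 4-Manifolds*, LNM 1374 (1989), Ch. VIII p. 50. [Kirby1989]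
-/

open scoped Manifold ContDiff Topology
open Set Function Bundle Filter Module

noncomputable section

namespace Literature.Topology.FourManifolds

/-! ### Pulling back a stable framing along an equidimensional immersion -/

section StablePullback

variable {E : Type*} [NormedAddCommGroup E] [NormedSpace ℝ E] [FiniteDimensional ℝ E]
  {H : Type*} [TopologicalSpace H] {I : ModelWithCorners ℝ E H}
  {H' : Type*} [TopologicalSpace H'] {I' : ModelWithCorners ℝ E H'}
  {M : Type*} [TopologicalSpace M] [ChartedSpace H M] [IsManifold I 1 M]
  {N : Type*} [TopologicalSpace N] [ChartedSpace H' N] [IsManifold I' 1 N]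

/-- **An equidimensional immersion into a manifold stably framed along it is stably
parallelizable**: with `φ : M → N` of class `C¹`, `dφ_x` invertible everywhere, and `(sᵢ)` a
continuous framing of `φ*TN ⊕ ℝ` (`HasStableTangentFramingAlong I' N φ`), the sections
`x ↦ ((dφ_x)⁻¹ (sᵢ x).1, (sᵢ x).2)` frame `TM ⊕ ℝ` (Hirsch 1976, Ch. 4 §1–§2: `TM ≅ φ*TN`,
whence `TM ⊕ ℝ ≅ φ*(TN ⊕ ℝ)`).  Continuity of the tangent components is checked in the
trivialisations of `TM` exactly as in `IsParallelizable.of_hasTangentFramingAlong_of_isInvertible_mfderiv`.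
[cite: Hirsch1976, Ch. 4 §1 p. 88 and §2] -/
theorem IsStablyParallelizable.of_hasStableTangentFramingAlong_of_isInvertible_mfderiv {φ : M → N}
    (hφ : ContMDiff I I' 1 φ) (hinv : ∀ x, (mfderiv I I' φ x).IsInvertible)
    (hs : HasStableTangentFramingAlong I' N φ) : IsStablyParallelizable I M := by
  obtain ⟨s, hsc, hsc', hli⟩ := hs
  refine ⟨fun i x => ((mfderiv I I' φ x).inverse (s i x).1, (s i x).2), fun i => ?_,
    fun i => hsc' i, fun x => ?_⟩
  · -- continuity of the tangent component of the `i`-th section, in the trivialisation at `x₀`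
    rw [continuous_iff_continuousAt]
    intro x₀
    rw [show (fun p : M => (TotalSpace.mk' E (id p) ((mfderiv I I' φ p).inverse (s i p).1) :
        TangentBundle I M)) = fun p : M => TotalSpace.mk' E p
          ((fun q : M => ((mfderiv I I' φ q).inverse (s i q).1 : TangentSpace I q)) p) from rfl,
      FiberBundle.continuousAt_section]
    set A : M → E →L[ℝ] E := inTangentCoordinates I I' id φ (mfderiv I I' φ) x₀ with hA
    have hAc : ContinuousAt A x₀ :=
      ((hφ x₀).mfderiv_const (m := 0) (by rw [zero_add])).continuousAt
    have hA0 : A x₀ = mfderiv I I' φ x₀ := by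
      rw [hA, inTangentCoordinates_eq _ _ _ (mem_chart_source H x₀) (mem_chart_source H' (φ x₀))]
      ext v
      change tangentCoordChange I' (φ x₀) (φ x₀) (φ x₀)
        (mfderiv I I' φ x₀ (tangentCoordChange I x₀ x₀ x₀ v)) = _
      rw [tangentCoordChange_self (by simp), tangentCoordChange_self (by simp)]
      rfl
    have hAinv : ∀ᶠ x in 𝓝 x₀, (A x).IsInvertible :=
      hAc.preimage_mem_nhds (isOpen_setOf_isInvertible.mem_nhds
        (by rw [mem_setOf_eq, hA0]; exact hinv x₀))
    have hσ : ContinuousAt (fun x => (trivializationAt E (TangentSpace I') (φ x₀)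
        (⟨φ x, (s i x).1⟩ : TangentBundle I' N)).2) x₀ := by
      have := (hsc i).continuousAt (x := x₀)
      rw [FiberBundle.continuousAt_totalSpace] at this
      exact this.2
    have h1 : ∀ᶠ x in 𝓝 x₀, x ∈ (chartAt H x₀).source :=
      (chartAt H x₀).open_source.mem_nhds (mem_chart_source H x₀)
    have h2 : ∀ᶠ x in 𝓝 x₀, φ x ∈ (chartAt H' (φ x₀)).source :=
      hφ.continuous.continuousAt.preimage_mem_nhds
        ((chartAt H' (φ x₀)).open_source.mem_nhds (mem_chart_source H' (φ x₀)))
    have hmem : ∀ᶠ x in 𝓝 x₀, x ∈ (chartAt H x₀).source ∧ φ x ∈ (chartAt H' (φ x₀)).source :=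
      h1.and h2
    have hid : ∀ᶠ x in 𝓝 x₀, A x ((trivializationAt E (TangentSpace I) x₀
        (⟨x, (mfderiv I I' φ x).inverse (s i x).1⟩ : TangentBundle I M)).2) =
          (trivializationAt E (TangentSpace I') (φ x₀) (⟨φ x, (s i x).1⟩ : TangentBundle I' N)).2 := by
      filter_upwards [hmem] with x hx
      rw [hA, inTangentCoordinates_eq _ _ _ (show id x ∈ (chartAt H (id x₀)).source from hx.1) hx.2,
        trivializationAt_snd_eq_tangentCoordChange, trivializationAt_snd_eq_tangentCoordChange]
      change tangentCoordChange I' (φ x) (φ x₀) (φ x) (mfderiv I I' φ x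
        (tangentCoordChange I x₀ x x (tangentCoordChange I x x₀ x
          ((mfderiv I I' φ x).inverse (s i x).1)))) = tangentCoordChange I' (φ x) (φ x₀) (φ x) (s i x).1
      have hx' : x ∈ (extChartAt I x).source ∩ (extChartAt I x₀).source ∩ (extChartAt I x).source := by
        simp only [extChartAt_source, mem_inter_iff, mem_chart_source, hx.1, and_self]
      rw [tangentCoordChange_comp hx', tangentCoordChange_self (by simp),
        (hinv x).self_apply_inverse]
    obtain ⟨e, he⟩ := (show (A x₀).IsInvertible by rw [hA0]; exact hinv x₀)
    have hinvc : ContinuousAt (fun x => (A x).inverse ((trivializationAt E (TangentSpace I')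
        (φ x₀) (⟨φ x, (s i x).1⟩ : TangentBundle I' N)).2)) x₀ := by
      have h1 : ContinuousAt ContinuousLinearMap.inverse (A x₀) := by
        rw [← he]
        exact (contDiffAt_map_inverse (n := 0) e).continuousAt
      exact (h1.comp hAc).clm_apply hσ
    refine hinvc.congr ?_
    filter_upwards [hid, hAinv] with x hx hxinv
    rw [← hx, hxinv.inverse_apply_self]
  · -- pointwise linear independence: `dφ_x ⊕ id` maps the family to the frame `(sᵢ x)ᵢ`
    beta_reduce
    refine LinearIndependent.of_comp
      ((show E →L[ℝ] E from mfderiv I I' φ x).toLinearMap.prodMap LinearMap.id) ?_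
    convert hli x using 1
    funext i
    exact Prod.ext ((hinv x).self_apply_inverse (s i x).1) rfl

end StablePullback

/-! ### Maps out of a glued manifold with boundary -/

namespace SmoothGlueData

universe uA uB

variable {n : ℕ} {A : Type uA} [TopologicalSpace A] [ChartedSpace (EuclideanHalfSpace (n + 1)) A]
  {B : Type uB} [TopologicalSpace B] [ChartedSpace (EuclideanHalfSpace (n + 1)) B]
  (d : SmoothGlueData (𝓡∂ (n + 1)) (𝓡∂ (n + 1)) A B (EuclideanSpace ℝ (Fin (n + 1))))
  [IsManifold (𝓡∂ (n + 1)) ∞ A] [IsManifold (𝓡∂ (n + 1)) ∞ B]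
  {E_Z H_Z : Type*} [NormedAddCommGroup E_Z] [NormedSpace ℝ E_Z] [TopologicalSpace H_Z]
  {I_Z : ModelWithCorners ℝ E_Z H_Z} {Z : Type*} [TopologicalSpace Z] [ChartedSpace H_Z Z]
  {fA : A → Z} {fB : B → Z} {h : ∀ a ∈ d.glue.source, fA a = fB (d.glue a)}

/-- **A map out of a glued manifold with boundary is smooth if both components are** (the pieces
embed as open submanifolds, `isSmoothEmbedding_inlH`, hence as local diffeomorphisms; cf.
`SmoothGlueData.contMDiff_lift` for boundaryless pieces). [cite: Kosinski1993, Ch. VI §1] -/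
theorem contMDiff_liftH (hA : ContMDiff (𝓡∂ (n + 1)) I_Z ∞ fA) (hB : ContMDiff (𝓡∂ (n + 1)) I_Z ∞ fB) :
    ContMDiff (𝓡∂ (n + 1)) I_Z ∞ (d.lift fA fB h) := by
  intro p
  rcases d.exists_inl_or_inr p with ⟨a, rfl⟩ | ⟨b, rfl⟩
  · haveI : Nonempty A := ⟨a⟩
    set Φ := openEmbeddingChart d.isSmoothEmbedding_inlH d.isOpen_range_inl with hΦ
    have heq : EqOn (d.lift fA fB h) (fA ∘ Φ.symm) (range d.inl) := by
      rintro _ ⟨a', rfl⟩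
      simp [Φ, openEmbeddingChart_symm_apply]
    have hsymm := contMDiffOn_openEmbeddingChart_symm d.isSmoothEmbedding_inlH d.isOpen_range_inl
    rw [openEmbeddingChart_target] at hsymm
    have hs : ContMDiffOn (𝓡∂ (n + 1)) I_Z ∞ (fA ∘ Φ.symm) (range d.inl) := hA.comp_contMDiffOn hsymm
    exact (hs.congr heq).contMDiffAt (d.isOpen_range_inl.mem_nhds ⟨a, rfl⟩)
  · haveI : Nonempty B := ⟨b⟩
    set Φ := openEmbeddingChart d.isSmoothEmbedding_inrH d.isOpen_range_inr with hΦ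
    have heq : EqOn (d.lift fA fB h) (fB ∘ Φ.symm) (range d.inr) := by
      rintro _ ⟨b', rfl⟩
      simp [Φ, openEmbeddingChart_symm_apply]
    have hsymm := contMDiffOn_openEmbeddingChart_symm d.isSmoothEmbedding_inrH d.isOpen_range_inr
    rw [openEmbeddingChart_target] at hsymm
    have hs : ContMDiffOn (𝓡∂ (n + 1)) I_Z ∞ (fB ∘ Φ.symm) (range d.inr) := hB.comp_contMDiffOn hsymm
    exact (hs.congr heq).contMDiffAt (d.isOpen_range_inr.mem_nhds ⟨b, rfl⟩)

/-- The differential of `inl : A → A ∪ B` is invertible (an open smooth embedding is a local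
diffeomorphism). [folklore] -/
theorem isInvertible_mfderiv_inlH (a : A) :
    (mfderiv (𝓡∂ (n + 1)) (𝓡∂ (n + 1)) d.inl a).IsInvertible := by
  haveI : Nonempty A := ⟨a⟩
  have hloc := isLocalDiffeomorph_of_isSmoothEmbedding_of_isOpen_range d.isSmoothEmbedding_inlH
    d.isOpen_range_inl a
  exact ⟨hloc.mfderivToContinuousLinearEquiv (by simp), hloc.mfderivToContinuousLinearEquiv_coe _⟩

/-- The differential of `inr : B → A ∪ B` is invertible. [folklore] -/
theorem isInvertible_mfderiv_inrH (b : B) :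
    (mfderiv (𝓡∂ (n + 1)) (𝓡∂ (n + 1)) d.inr b).IsInvertible := by
  haveI : Nonempty B := ⟨b⟩
  have hloc := isLocalDiffeomorph_of_isSmoothEmbedding_of_isOpen_range d.isSmoothEmbedding_inrH
    d.isOpen_range_inr b
  exact ⟨hloc.mfderivToContinuousLinearEquiv (by simp), hloc.mfderivToContinuousLinearEquiv_coe _⟩

/-- **The differential of a map out of a glued manifold with boundary at a point of the first
piece is invertible if that of its first component is**: `d(fA)_a = d(lift)_{inl a} ∘ d(inl)_a`
with `d(inl)_a` invertible. [folklore] -/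
theorem isInvertible_mfderiv_lift_inl [IsManifold I_Z ∞ Z] (hA : ContMDiff (𝓡∂ (n + 1)) I_Z ∞ fA)
    (hB : ContMDiff (𝓡∂ (n + 1)) I_Z ∞ fB) (a : A)
    (ha : (mfderiv (𝓡∂ (n + 1)) I_Z fA a).IsInvertible) :
    (mfderiv (𝓡∂ (n + 1)) I_Z (d.lift fA fB h) (d.inl a)).IsInvertible := by
  have hD := d.isInvertible_mfderiv_inlH a
  have key : mfderiv (𝓡∂ (n + 1)) I_Z (d.lift fA fB h) (d.inl a) =
      ((mfderiv (𝓡∂ (n + 1)) I_Z (d.lift fA fB h) (d.inl a)).comp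
        (mfderiv (𝓡∂ (n + 1)) (𝓡∂ (n + 1)) d.inl a)).comp
          (mfderiv (𝓡∂ (n + 1)) (𝓡∂ (n + 1)) d.inl a).inverse := by
    rw [ContinuousLinearMap.comp_assoc, hD.self_comp_inverse, ContinuousLinearMap.comp_id]
  rw [key]
  refine ContinuousLinearMap.IsInvertible.comp ?_ hD.inverse
  have hcomp := mfderiv_comp a ((d.contMDiff_liftH (h := h) hA hB (d.inl a)).mdifferentiableAt (by simp))
    (d.contMDiff_inlH.mdifferentiableAt (by simp))
  rw [← hcomp]
  exact ha

/-- The same at a point of the second piece. [folklore] -/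
theorem isInvertible_mfderiv_lift_inr [IsManifold I_Z ∞ Z] (hA : ContMDiff (𝓡∂ (n + 1)) I_Z ∞ fA)
    (hB : ContMDiff (𝓡∂ (n + 1)) I_Z ∞ fB) (b : B)
    (hb : (mfderiv (𝓡∂ (n + 1)) I_Z fB b).IsInvertible) :
    (mfderiv (𝓡∂ (n + 1)) I_Z (d.lift fA fB h) (d.inr b)).IsInvertible := by
  have hD := d.isInvertible_mfderiv_inrH b
  have key : mfderiv (𝓡∂ (n + 1)) I_Z (d.lift fA fB h) (d.inr b) =
      ((mfderiv (𝓡∂ (n + 1)) I_Z (d.lift fA fB h) (d.inr b)).comp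
        (mfderiv (𝓡∂ (n + 1)) (𝓡∂ (n + 1)) d.inr b)).comp
          (mfderiv (𝓡∂ (n + 1)) (𝓡∂ (n + 1)) d.inr b).inverse := by
    rw [ContinuousLinearMap.comp_assoc, hD.self_comp_inverse, ContinuousLinearMap.comp_id]
  rw [key]
  refine ContinuousLinearMap.IsInvertible.comp ?_ hD.inverse
  have hcomp := mfderiv_comp b ((d.contMDiff_liftH (h := h) hA hB (d.inr b)).mdifferentiableAt (by simp))
    (d.contMDiff_inrH.mdifferentiableAt (by simp))
  rw [← hcomp]
  exact hb

end SmoothGlueData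

/-! ### The ball complement `K → W` -/

namespace BallRemovalData

open BallRemoval

universe u

variable {n : ℕ} {W : Type u} [TopologicalSpace W] [T2Space W]
  [ChartedSpace (EuclideanHalfSpace (n + 1)) W] [IsManifold (𝓡∂ (n + 1)) ∞ W] (D : BallRemovalData n W)

/-- On the gluing region the two maps `a ↦ a` and `b ↦ i(b/‖b‖²)` to `W` agree: for `a = i(v)`,
`1 < ‖v‖ < 2`, glued to `b = v/‖v‖²`, one has `i(b/‖b‖²) = i(v) = a` (the compatibility used by
`BallRemovalData.toCompl`). [cite: KervaireMilnorAnnals1963, Lemma 2.3, proof (p. 506)] -/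
theorem val_eq_glueInvPt_glue :
    ∀ a ∈ D.glueData.glue.source, (a : W) = D.glueInvPt (D.glueData.glue a) := by
  intro a ha
  obtain ⟨hr, hs⟩ := D.mem_glueSource_iff.1 ha
  show (a : W) = D.glueInvPt (D.glueFun a)
  rw [glueInvPt, D.coe_glueFun_of_mem ha, sphInv_sphInv (ne_zero_of_mem_shell hs), D.i_j hr]

/-- **The map `K = A ∪ B → W`** (`a ↦ a`, `b ↦ i(b/‖b‖²)`; the composite of
`BallRemovalData.toCompl` with the inclusion `W ∖ i(B̊) ⊆ W`) **is smooth**.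
[cite: KervaireMilnorAnnals1963, Lemma 2.3, proof (p. 506)] -/
theorem contMDiff_toAmbient :
    ContMDiff (𝓡∂ (n + 1)) (𝓡∂ (n + 1)) ∞
      (D.glueData.lift Subtype.val D.glueInvPt D.val_eq_glueInvPt_glue) :=
  D.glueData.contMDiff_liftH (contMDiff_subtype_val (n := (∞ : ℕ∞ω))) D.contMDiff_glueInvPt

omit [T2Space W] [IsManifold (𝓡∂ (n + 1)) ∞ W] in
/-- The differential of `b ↦ i(b/‖b‖²) : B → W` is invertible: `B ⊆ 𝔻ⁿ⁺¹ ⊆ ℝⁿ⁺¹` are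
equidimensional inclusions (`isInvertible_mfderiv_coe_closedBall`), the inversion has invertible
derivative off `0` (`BallRemoval.isInvertible_mfderiv_sphInv`) and the disc `i` is an open smooth
embedding, hence a local diffeomorphism. [folklore] -/
theorem isInvertible_mfderiv_glueInvPt (b : B n) :
    (mfderiv (𝓡∂ (n + 1)) (𝓡∂ (n + 1)) D.glueInvPt b).IsInvertible := by
  -- the four factors
  have hb0 : ((b : Metric.closedBall (0 : EuclideanSpace ℝ (Fin (n + 1))) 1) :
      EuclideanSpace ℝ (Fin (n + 1))) ≠ 0 := B_ne_zero b
  haveI : Nonempty (B n) := ⟨b⟩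
  have h1loc := isLocalDiffeomorph_of_isSmoothEmbedding_of_isOpen_range
    (Manifold.IsSmoothEmbedding.of_opens (I := 𝓡∂ (n + 1)) (n := ∞) (B n))
    (by rw [Subtype.range_coe]; exact (B n).isOpen) b
  have h1 : (mfderiv (𝓡∂ (n + 1)) (𝓡∂ (n + 1))
      (Subtype.val : B n → Metric.closedBall (0 : EuclideanSpace ℝ (Fin (n + 1))) 1) b).IsInvertible :=
    ⟨h1loc.mfderivToContinuousLinearEquiv (by simp), h1loc.mfderivToContinuousLinearEquiv_coe _⟩
  have h2 := isInvertible_mfderiv_coe_closedBall (n := n)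
    (b : Metric.closedBall (0 : EuclideanSpace ℝ (Fin (n + 1))) 1)
  have h3 := BallRemoval.isInvertible_mfderiv_sphInv hb0
  haveI : Nonempty (EuclideanSpace ℝ (Fin (n + 1))) := ⟨0⟩
  have h4loc := isLocalDiffeomorph_of_isSmoothEmbedding_of_isOpen_range D.isSmoothEmbedding_i
    D.isOpen_range (sphInv ((b : Metric.closedBall (0 : EuclideanSpace ℝ (Fin (n + 1))) 1) :
      EuclideanSpace ℝ (Fin (n + 1))))
  have h4 : (mfderiv 𝓘(ℝ, EuclideanSpace ℝ (Fin (n + 1))) (𝓡∂ (n + 1)) D.i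
      (sphInv ((b : Metric.closedBall (0 : EuclideanSpace ℝ (Fin (n + 1))) 1) :
        EuclideanSpace ℝ (Fin (n + 1))))).IsInvertible :=
    ⟨h4loc.mfderivToContinuousLinearEquiv (by simp), h4loc.mfderivToContinuousLinearEquiv_coe _⟩
  -- differentiability of the factors
  have hd1 : MDifferentiableAt (𝓡∂ (n + 1)) (𝓡∂ (n + 1))
      (Subtype.val : B n → Metric.closedBall (0 : EuclideanSpace ℝ (Fin (n + 1))) 1) b :=
    (contMDiff_subtype_val (n := (∞ : ℕ∞ω))).mdifferentiableAt (by simp)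
  have hd2 : MDifferentiableAt (𝓡∂ (n + 1)) 𝓘(ℝ, EuclideanSpace ℝ (Fin (n + 1)))
      (Subtype.val : Metric.closedBall (0 : EuclideanSpace ℝ (Fin (n + 1))) 1 →
        EuclideanSpace ℝ (Fin (n + 1))) b :=
    contMDiff_coe_closedBall.mdifferentiableAt (by simp)
  have hd3 := BallRemoval.mdifferentiableAt_sphInv hb0
  have hd4 : MDifferentiableAt 𝓘(ℝ, EuclideanSpace ℝ (Fin (n + 1))) (𝓡∂ (n + 1)) D.i
      (sphInv ((b : Metric.closedBall (0 : EuclideanSpace ℝ (Fin (n + 1))) 1) :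
        EuclideanSpace ℝ (Fin (n + 1)))) :=
    (D.contMDiff_i _).mdifferentiableAt (by simp)
  -- the chain rule
  have h12 := mfderiv_comp b hd2 hd1
  have hd12 : MDifferentiableAt (𝓡∂ (n + 1)) 𝓘(ℝ, EuclideanSpace ℝ (Fin (n + 1)))
      ((Subtype.val : Metric.closedBall (0 : EuclideanSpace ℝ (Fin (n + 1))) 1 →
        EuclideanSpace ℝ (Fin (n + 1))) ∘
        (Subtype.val : B n → Metric.closedBall (0 : EuclideanSpace ℝ (Fin (n + 1))) 1)) b :=
    hd2.comp b hd1
  have h123 := mfderiv_comp b hd3 hd12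
  have hd123 : MDifferentiableAt (𝓡∂ (n + 1)) 𝓘(ℝ, EuclideanSpace ℝ (Fin (n + 1)))
      (sphInv ∘ ((Subtype.val : Metric.closedBall (0 : EuclideanSpace ℝ (Fin (n + 1))) 1 →
        EuclideanSpace ℝ (Fin (n + 1))) ∘
        (Subtype.val : B n → Metric.closedBall (0 : EuclideanSpace ℝ (Fin (n + 1))) 1))) b :=
    hd3.comp b hd12
  have h1234 := mfderiv_comp b hd4 hd123
  have heq : D.glueInvPt = D.i ∘ (sphInv ∘ ((Subtype.val : Metric.closedBall (0 : EuclideanSpace ℝ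
      (Fin (n + 1))) 1 → EuclideanSpace ℝ (Fin (n + 1))) ∘
        (Subtype.val : B n → Metric.closedBall (0 : EuclideanSpace ℝ (Fin (n + 1))) 1))) := rfl
  rw [heq, h1234, h123, h12]
  exact h4.comp (h3.comp (h2.comp h1))

/-- **The differential of `K → W` is invertible everywhere** (on `A` it is that of the inclusion of
an open submanifold, on `B` that of `b ↦ i(b/‖b‖²)`). [folklore] -/
theorem isInvertible_mfderiv_toAmbient (k : D.K) :
    (mfderiv (𝓡∂ (n + 1)) (𝓡∂ (n + 1))
      (D.glueData.lift Subtype.val D.glueInvPt D.val_eq_glueInvPt_glue) k).IsInvertible := by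
  rcases D.glueData.exists_inl_or_inr k with ⟨a, rfl⟩ | ⟨b, rfl⟩
  · refine D.glueData.isInvertible_mfderiv_lift_inl (contMDiff_subtype_val (n := (∞ : ℕ∞ω)))
      D.contMDiff_glueInvPt a ?_
    haveI : Nonempty D.A := ⟨a⟩
    have hloc := isLocalDiffeomorph_of_isSmoothEmbedding_of_isOpen_range
      (Manifold.IsSmoothEmbedding.of_opens (I := 𝓡∂ (n + 1)) (n := ∞) D.A)
      (by rw [Subtype.range_coe]; exact D.A.isOpen) a
    exact ⟨hloc.mfderivToContinuousLinearEquiv (by simp), hloc.mfderivToContinuousLinearEquiv_coe _⟩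
  · exact D.glueData.isInvertible_mfderiv_lift_inr (contMDiff_subtype_val (n := (∞ : ℕ∞ω)))
      D.contMDiff_glueInvPt b
      (D.isInvertible_mfderiv_glueInvPt b)

/-- **The ball complement of a parallelizable manifold is parallelizable**: `K = W ∖ i(B̊)` maps to
`W` by a smooth equidimensional immersion, along which the framing of `TW` pulls back
(`IsParallelizable.of_hasTangentFramingAlong_of_isInvertible_mfderiv`; Hirsch 1976, Ch. 4 §1–§2).
This is the framing of the cobordism `(K; M, Sⁿ)` cut out of a parallelizable null-cobordism
(Kervaire–Milnor 1963, proof of Lemma 2.3). [cite: KervaireMilnorAnnals1963, Lemma 2.3, proof (p. 506)] [cite: Hirsch1976, Ch. 4 §1 p. 88 and §2] -/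
theorem isParallelizable_K (hW : IsParallelizable (𝓡∂ (n + 1)) W) :
    IsParallelizable (𝓡∂ (n + 1)) D.K :=
  IsParallelizable.of_hasTangentFramingAlong_of_isInvertible_mfderiv
    (D.contMDiff_toAmbient.of_le (by exact_mod_cast le_top)) D.isInvertible_mfderiv_toAmbient
    (HasTangentFramingAlong.comp hW ⟨_, D.contMDiff_toAmbient.continuous⟩)

/-- **The ball complement of a stably parallelizable manifold is stably parallelizable** (the
stable framing of `TW ⊕ ℝ` pulls back along `K → W`,
`IsStablyParallelizable.of_hasStableTangentFramingAlong_of_isInvertible_mfderiv`).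
[cite: KervaireMilnorAnnals1963, §3 p. 508 and Lemma 2.3, proof (p. 506)] [cite: Hirsch1976, Ch. 4 §1 p. 88 and §2] -/
theorem isStablyParallelizable_K (hW : IsStablyParallelizable (𝓡∂ (n + 1)) W) :
    IsStablyParallelizable (𝓡∂ (n + 1)) D.K :=
  IsStablyParallelizable.of_hasStableTangentFramingAlong_of_isInvertible_mfderiv
    (D.contMDiff_toAmbient.of_le (by exact_mod_cast le_top)) D.isInvertible_mfderiv_toAmbient
    (HasStableTangentFramingAlong.comp hW ⟨_, D.contMDiff_toAmbient.continuous⟩)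

end BallRemovalData

/-! ### A closed manifold recharted on the half-space keeps its framings -/

namespace HalfSpaceCharted

universe u

variable {n : ℕ} {X : Type u} [TopologicalSpace X] [ChartedSpace (EuclideanSpace ℝ (Fin (n + 1))) X]
  [IsManifold (𝓡 (n + 1)) ∞ X]

/-- **`HalfSpaceCharted X` is stably parallelizable when `X` is**: pull the stable framing back
along the identity `HalfSpaceCharted X → X`, which is smooth with invertible differential
(`HalfSpaceCharted.contMDiff_of_symm`, `HalfSpaceCharted.isInvertible_mfderiv_of_symm`).
[cite: Hirsch1976, Ch. 4 §1 p. 88 and §2] -/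
theorem isStablyParallelizable (h : IsStablyParallelizable (𝓡 (n + 1)) X) :
    IsStablyParallelizable (𝓡∂ (n + 1)) (HalfSpaceCharted X) :=
  IsStablyParallelizable.of_hasStableTangentFramingAlong_of_isInvertible_mfderiv
    ((HalfSpaceCharted.contMDiff_of_symm (n := n) (X := X)).of_le (by exact_mod_cast le_top))
    HalfSpaceCharted.isInvertible_mfderiv_of_symm
    (HasStableTangentFramingAlong.comp h ⟨_, (HalfSpaceCharted.contMDiff_of_symm (n := n) (X := X)).continuous⟩)

/-- **`HalfSpaceCharted X` is parallelizable when `X` is.** [cite: Hirsch1976, Ch. 4 §1 p. 88 and §2] -/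
theorem isParallelizable (h : IsParallelizable (𝓡 (n + 1)) X) :
    IsParallelizable (𝓡∂ (n + 1)) (HalfSpaceCharted X) :=
  IsParallelizable.of_hasTangentFramingAlong_of_isInvertible_mfderiv
    ((HalfSpaceCharted.contMDiff_of_symm (n := n) (X := X)).of_le (by exact_mod_cast le_top))
    HalfSpaceCharted.isInvertible_mfderiv_of_symm
    (HasTangentFramingAlong.comp h ⟨_, (HalfSpaceCharted.contMDiff_of_symm (n := n) (X := X)).continuous⟩)

end HalfSpaceCharted

end Literature.Topology.FourManifolds

end
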